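import Mathlib.NumberTheory.NumberField.Units.Basic
import Mathlib.Data.Nat.Factorization.Basic
import Literature.NumberTheory.LocalFields.PadicRootsOfUnity
import HarnessLib

/-!
# The roots of unity of `ℚ₂` are `±1`; a number field with a ring map into `ℚ₂` has `μ(K) = {±1}` (`w_K = #μ(K) = 2`)

Topic `NumberTheory/NumberFields` (namespace = path).  THEOREM-ONLY file (no definition, no named fact, no instance, no `sorry`), written
by the prover seat `bsd-line-att-p3` g27 (cell `bsd-f1-sign2`; `--supports` stmt-BirchSwinnertonDyer-22298; closes nothing).

Neukirch, *Algebraic Number Theory*, Ch. II §5, Prop. (5.7): for `p ≠ 2`, `ℚ_pˣ ≅ ℤ ⊕ ℤ/(p−1) ⊕ ℤ_p`; **for `p = 2`, `ℚ₂ˣ ≅ ℤ ⊕ ℤ/2 ⊕ ℤ₂`** — in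
particular the torsion of `ℚ₂ˣ` is `{±1}` (Serre, *A Course in Arithmetic*, Ch. II §3.1: `U = U₁ = {±1} × U₂`, `U₂ ≅ ℤ₂`).  We prove the torsion
statement directly (no logarithm): a root of unity `y ∈ ℤ₂` of ODD order `m` is `1` because `1 + y + ⋯ + y^{m−1} ≡ m ≡ 1 (mod 2)` is a unit and
`(y − 1)(1 + y + ⋯ + y^{m−1}) = yᵐ − 1 = 0`; there is no element of order `4` because `−1` is not a square modulo `4`; induction on the `2`-part of the
order finishes.  CONSEQUENCE (the non-archimedean twin of Mathlib's `NumberField.Units.torsionOrder_eq_two_of_odd_finrank`, whose proof uses a real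
place): **a number field `K` admitting a ring homomorphism `K → ℚ₂`** — equivalently a prime of `K` above `2` with `e = f = 1`, e.g. `2` split in an
imaginary quadratic field, or ANY Galois number field whose defining polynomial splits over `ℚ₂` — **has `NumberField.Units.torsionOrder K = 2`**:
its only roots of unity are `±1`.  This discharges hypotheses of the shape `(hμ : Units.torsionOrder K = 2)` (tree: Arthur-2013 torus leaves,
`TorusCapitulation.lean` etc.) and the `Nat.log 2 (torsionOrder K)` term of Chevalley's count along cyclotomic `ℤ₂`-towers
(`Summits/…/AlignedTransportAtTwoMainConjectureOfRankZeroBSDAtTwoZpTowerChevalleyGrowth.lean`: `e_0 + s·n ≤ e_n + n + n·u + log₂ #μ(K)`).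

* §1 `ℤ₂` / `ℚ₂`: `padicIntTwo_eq_one_of_pow_eq_one_of_odd` (from the tree's one-unit lemma
  `LocalFields.padicInt_eq_one_of_pow_eq_one_of_norm_sub_one_lt`: at `p = 2` EVERY unit is a one-unit),
  **`padicIntTwo_eq_one_or_eq_neg_one_of_pow_eq_one`**, **`padicTwo_eq_one_or_eq_neg_one_of_pow_eq_one`** (`xⁿ = 1`, `n ≠ 0` ⟹ `x = ±1`),
  `padicTwo_eq_one_or_eq_neg_one_of_isOfFinOrder`.  (The tree's `LocalFields/PadicRootsOfUnity.lean` treats orders PRIME TO `p` and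
  `LocalFields/PadicMultiplicativeGroupStructure.lean` the decomposition `ℚ₂ˣ = 2^ℤ·{±1}·5^{ℤ₂}`; the torsion statement itself was not in the tree.
  A librarian may re-home §1 under `Literature/NumberTheory/LocalFields/`.)
* §2 number fields: `torsion_eq_one_or_neg_one_of_ringHom_padicTwo`, ★ **`torsionOrder_eq_two_of_ringHom_padicTwo`**,
  `torsionOrder_eq_two_of_algHom_padicTwo`, `log_two_torsionOrder_eq_one_of_ringHom_padicTwo` (`Nat.log 2 (torsionOrder K) = 1`),
  `eq_one_or_eq_neg_one_of_pow_eq_one_of_ringHom_padicTwo` (field elements).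

Deliberately NOT here: odd `p` (`μ(ℚ_p) = μ_{p−1}`, Teichmüller — Mathlib has the `(p−1)`-st roots via Hensel but not the torsion-freeness of
`1 + pℤ_p` in this elementary form); the construction of `K → ℚ₂` from a degree-one prime (tree, Summits side:
`…CubicOffStratumPrimes.exists_ringHom_padic_of_ramificationIdx_eq_one_of_inertiaDeg_eq_one`).

References: [NeukirchANT1999] J. Neukirch, *Algebraic Number Theory*, Ch. II §5 Prop. (5.7); [Serre1973CourseArithmetic] J.-P. Serre, *A Course in
Arithmetic*, Ch. II §3.1 (structure of `U₁` for `p = 2`); [Gouvea1993PadicNumbers] F. Gouvêa, *p-adic Numbers*, §5.7, Problems 177–178 and the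
summary after them («for `p = 2`, the only roots of unity in `ℚ_p` are `±1`», held text pdf p. 122); [Washington1997] L. Washington,
*Introduction to Cyclotomic Fields*, §13.1 / Lemma 13.18 (where `#μ(K)` enters the unit index of Chevalley's formula).
presearch: «roots of unity of ℚ₂ are ±1» → [corpus: book:gouvea1993-p-adic-numbers pdf p.122] (statement + exercise); galaxy (all stars) none.
-/

set_option autoImplicit false

noncomputable section

namespace Literature.NumberTheory.NumberFields

/-! ## §1 The roots of unity of `ℤ₂` and `ℚ₂` -/

section PadicTwo

/-- `−1` is not a square in `ℤ₂`: reduce modulo `4`. [folklore] -/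
private theorem padicIntTwo_sq_ne_neg_one (y : ℤ_[2]) : y ^ 2 ≠ -1 := by
  intro h
  have h4 : ∀ z : ZMod 4, z ^ 2 ≠ -1 := by decide
  have := congrArg (PadicInt.toZModPow 2) h
  rw [map_pow, map_neg, map_one] at this
  exact h4 _ (by simpa using this)

/-- The only unit of `𝔽₂` is `1`: `zᵐ = 1` in `ZMod 2` with `m ≠ 0` forces `z = 1`. [folklore] -/
private theorem zmod_two_eq_one_of_pow_eq_one {z : ZMod 2} {m : ℕ} (hm : m ≠ 0) (h : z ^ m = 1) : z = 1 := by
  have key : ∀ w : ZMod 2, w = 0 ∨ w = 1 := by decide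
  rcases key z with rfl | rfl
  · rw [zero_pow hm] at h
    exact absurd h zero_ne_one
  · rfl

/-- **A root of unity of ODD order in `ℤ₂` is `1`**: if `yᵐ = 1` with `m` odd then `y = 1`.  At `p = 2` the residue field is `𝔽₂`, so every
unit `y` is a ONE-unit (`‖y − 1‖ < 1`), and the tree's `LocalFields.padicInt_eq_one_of_pow_eq_one_of_norm_sub_one_lt` (the geometric sum
`1 + y + ⋯ + y^{m−1} ≡ m ≢ 0` is a unit killing `y − 1`) applies. [cite: NeukirchANT1999, Ch. II §5 Prop. (5.7)]
[cite: Gouvea1993PadicNumbers, §5.7 Problems 177–178] -/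
theorem padicIntTwo_eq_one_of_pow_eq_one_of_odd {y : ℤ_[2]} {m : ℕ} (hm : Odd m) (h : y ^ m = 1) : y = 1 := by
  have hm0 : m ≠ 0 := hm.pos.ne'
  have hm2 : ¬ 2 ∣ m := hm.not_two_dvd_nat
  -- at `p = 2` every unit is a one-unit: `ȳ = 1` in `𝔽₂`, so `‖y - 1‖ < 1`
  have hy : PadicInt.toZMod y = 1 :=
    zmod_two_eq_one_of_pow_eq_one hm0 (by rw [← map_pow, h, map_one])
  have hker : y - 1 ∈ RingHom.ker (PadicInt.toZMod : ℤ_[2] →+* ZMod 2) := by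
    rw [RingHom.mem_ker, map_sub, hy, map_one, sub_self]
  rw [PadicInt.ker_toZMod, IsLocalRing.mem_maximalIdeal] at hker
  exact LocalFields.padicInt_eq_one_of_pow_eq_one_of_norm_sub_one_lt hm2 h (PadicInt.mem_nonunits.mp hker)

/-- A root of unity of `2`-power order in `ℤ₂` is `±1` (no element of order `4`: its square would be `−1`). [folklore] -/
private theorem padicIntTwo_eq_one_or_eq_neg_one_of_pow_two_pow_eq_one {y : ℤ_[2]} :
    ∀ {a : ℕ}, y ^ 2 ^ a = 1 → y = 1 ∨ y = -1
  | 0, h => Or.inl (by simpa using h)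
  | a + 1, h => by
    rw [pow_succ, pow_mul] at h
    rcases eq_or_eq_neg_of_sq_eq_sq (y ^ 2 ^ a) 1 (by rw [h, one_pow]) with h1 | h1
    · exact padicIntTwo_eq_one_or_eq_neg_one_of_pow_two_pow_eq_one h1
    · cases a with
      | zero => exact Or.inr (by simpa using h1)
      | succ b =>
        exfalso
        rw [pow_succ, pow_mul] at h1
        exact padicIntTwo_sq_ne_neg_one _ h1

/-- **The roots of unity of `ℤ₂` are `±1`**: `yⁿ = 1` with `n ≠ 0` forces `y = 1 ∨ y = −1` (write `n = 2ᵃ·m`, `m` odd: `(y^{2ᵃ})ᵐ = 1` gives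
`y^{2ᵃ} = 1`, then no element of order `4`). [cite: NeukirchANT1999, Ch. II §5 Prop. (5.7)] [cite: Serre1973CourseArithmetic, Ch. II §3.1] -/
theorem padicIntTwo_eq_one_or_eq_neg_one_of_pow_eq_one {y : ℤ_[2]} {n : ℕ} (hn : n ≠ 0) (h : y ^ n = 1) : y = 1 ∨ y = -1 := by
  obtain ⟨a, m, hm, rfl⟩ := Nat.exists_eq_two_pow_mul_odd hn
  have h1 : (y ^ 2 ^ a) ^ m = 1 := by rwa [← pow_mul]
  have h2 : y ^ 2 ^ a = 1 := padicIntTwo_eq_one_of_pow_eq_one_of_odd hm h1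
  exact padicIntTwo_eq_one_or_eq_neg_one_of_pow_two_pow_eq_one h2

/-- **The roots of unity of `ℚ₂` are `±1`** (`μ(ℚ₂) = {±1}`, the torsion of `ℚ₂ˣ ≅ ℤ ⊕ ℤ/2 ⊕ ℤ₂`): `xⁿ = 1`, `n ≠ 0` ⟹ `x = 1 ∨ x = −1`
(a root of unity has norm `1` — tree `LocalFields.padic_norm_eq_one_of_pow_eq_one` — hence lies in `ℤ₂`). [cite: NeukirchANT1999, Ch. II §5 Prop. (5.7)]
[cite: Serre1973CourseArithmetic, Ch. II §3.1] [cite: Gouvea1993PadicNumbers, §5.7, summary after Problem 178] -/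
theorem padicTwo_eq_one_or_eq_neg_one_of_pow_eq_one {x : ℚ_[2]} {n : ℕ} (hn : n ≠ 0) (h : x ^ n = 1) : x = 1 ∨ x = -1 := by
  have hx : ‖x‖ = 1 := LocalFields.padic_norm_eq_one_of_pow_eq_one hn h
  set y : ℤ_[2] := ⟨x, hx.le⟩ with hy
  have hyx : (y : ℚ_[2]) = x := rfl
  have hyn : y ^ n = 1 := by
    apply Subtype.ext
    rw [PadicInt.coe_pow, hyx, h, PadicInt.coe_one]
  rcases padicIntTwo_eq_one_or_eq_neg_one_of_pow_eq_one hn hyn with h1 | h1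
  · left; rw [← hyx, h1, PadicInt.coe_one]
  · right; rw [← hyx, h1, PadicInt.coe_neg, PadicInt.coe_one]

/-- An element of finite order of `ℚ₂ˣ`/`ℚ₂` is `±1`. [cite: NeukirchANT1999, Ch. II §5 Prop. (5.7)] -/
theorem padicTwo_eq_one_or_eq_neg_one_of_isOfFinOrder {x : ℚ_[2]} (hx : IsOfFinOrder x) : x = 1 ∨ x = -1 := by
  obtain ⟨n, hn, h⟩ := (isOfFinOrder_iff_pow_eq_one).mp hx
  exact padicTwo_eq_one_or_eq_neg_one_of_pow_eq_one hn.ne' h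

end PadicTwo

/-! ## §2 Number fields with a ring map into `ℚ₂`: `μ(K) = {±1}`, `torsionOrder K = 2` -/

section NumberField

open NumberField NumberField.Units

variable {K : Type*} [Field K] [NumberField K]

/-- In a number field with a ring map `σ : K → ℚ₂`, every solution of `xⁿ = 1` (`n ≠ 0`) is `±1` (push forward along the injective `σ`).
[cite: NeukirchANT1999, Ch. II §5 Prop. (5.7)] -/
theorem eq_one_or_eq_neg_one_of_pow_eq_one_of_ringHom_padicTwo (σ : K →+* ℚ_[2]) {x : K} {n : ℕ} (hn : n ≠ 0) (h : x ^ n = 1) :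
    x = 1 ∨ x = -1 := by
  have h1 : σ x ^ n = 1 := by rw [← map_pow, h, map_one]
  rcases padicTwo_eq_one_or_eq_neg_one_of_pow_eq_one hn h1 with h2 | h2
  · left; exact σ.injective (by rw [h2, map_one])
  · right; exact σ.injective (by rw [h2, map_neg, map_one])

omit [NumberField K] in
/-- Every torsion unit of a number field with a ring map into `ℚ₂` is `±1` (the non-archimedean twin of Mathlib's
`torsion_eq_one_or_neg_one_of_odd_finrank`). [cite: NeukirchANT1999, Ch. II §5 Prop. (5.7)] [cite: Washington1997, §13.1] -/
theorem torsion_eq_one_or_neg_one_of_ringHom_padicTwo (σ : K →+* ℚ_[2]) (x : torsion K) :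
    (x : (𝓞 K)ˣ) = 1 ∨ (x : (𝓞 K)ˣ) = -1 := by
  have hfin : IsOfFinOrder (x : (𝓞 K)ˣ) := (CommGroup.mem_torsion _).mp x.2
  obtain ⟨n, hn, hxn⟩ := (isOfFinOrder_iff_pow_eq_one).mp hfin
  have hK : (((x : (𝓞 K)ˣ) : K)) ^ n = 1 := by rw [← coe_pow, hxn, coe_one]
  have h1 : σ ((x : (𝓞 K)ˣ) : K) ^ n = 1 := by rw [← map_pow, hK, map_one]
  rcases padicTwo_eq_one_or_eq_neg_one_of_pow_eq_one hn.ne' h1 with h2 | h2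
  · left
    have h3 : ((x : (𝓞 K)ˣ) : K) = ((1 : (𝓞 K)ˣ) : K) := by
      rw [coe_one]
      exact σ.injective (by rw [h2, map_one])
    exact coe_injective K h3
  · right
    have h3 : ((x : (𝓞 K)ˣ) : K) = ((-1 : (𝓞 K)ˣ) : K) := by
      rw [coe_neg_one]
      exact σ.injective (by rw [h2, map_neg, map_one])
    exact coe_injective K h3

/-- ★ **A number field with a ring map into `ℚ₂` has exactly two roots of unity: `NumberField.Units.torsionOrder K = 2`** (`μ(K) = {±1}`;
e.g. any `K` with a prime above `2` of ramification index and residue degree `1`). [cite: NeukirchANT1999, Ch. II §5 Prop. (5.7)]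
[cite: Washington1997, §13.1] -/
theorem torsionOrder_eq_two_of_ringHom_padicTwo (σ : K →+* ℚ_[2]) : torsionOrder K = 2 := by
  classical
  let _ := Fintype.ofFinite (torsion K)
  rw [torsionOrder, Nat.card_eq_fintype_card]
  refine (Finset.card_eq_two.2 ⟨1, ⟨-1, neg_one_mem_torsion⟩,
    by simp [← Subtype.coe_ne_coe], Finset.ext fun x ↦ ⟨fun _ ↦ ?_, fun _ ↦ Finset.mem_univ _⟩⟩)
  rw [Finset.mem_insert, Finset.mem_singleton, ← Subtype.val_inj, ← Subtype.val_inj]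
  exact torsion_eq_one_or_neg_one_of_ringHom_padicTwo σ x

/-- `ℚ`-algebra-map form: `K →ₐ[ℚ] ℚ₂` ⟹ `torsionOrder K = 2`. [cite: NeukirchANT1999, Ch. II §5 Prop. (5.7)] -/
theorem torsionOrder_eq_two_of_algHom_padicTwo (φ : K →ₐ[ℚ] ℚ_[2]) : torsionOrder K = 2 :=
  torsionOrder_eq_two_of_ringHom_padicTwo (φ : K →+* ℚ_[2])

/-- `Nonempty`-form (as produced by `IntermediateField.nonempty_algHom_adjoin_of_splits`). [cite: NeukirchANT1999, Ch. II §5 Prop. (5.7)] -/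
theorem torsionOrder_eq_two_of_nonempty_algHom_padicTwo (h : Nonempty (K →ₐ[ℚ] ℚ_[2])) : torsionOrder K = 2 := by
  obtain ⟨φ⟩ := h
  exact torsionOrder_eq_two_of_algHom_padicTwo φ

/-- **The `log₂ #μ(K)` term of Chevalley's count is `1`**: `Nat.log 2 (torsionOrder K) = 1` for `K` with a ring map into `ℚ₂`.
[cite: Washington1997, §13.1] [cite: NeukirchANT1999, Ch. II §5 Prop. (5.7)] -/
theorem log_two_torsionOrder_eq_one_of_ringHom_padicTwo (σ : K →+* ℚ_[2]) : Nat.log 2 (torsionOrder K) = 1 := by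
  rw [torsionOrder_eq_two_of_ringHom_padicTwo σ]
  decide

end NumberField

end Literature.NumberTheory.NumberFields

end
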